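import Summits.QuantumFields.YangMills.Theorems.UnitScaleTiltProp7SectET3H137RowsT3
import Summits.QuantumFields.YangMills.Theorems.UnitScaleTiltProp7SectET3DeltaEtaExplicitT3
import HarnessLib

/-!
# Route `UnitScaleTilt`, crux «MinimiserStabilityRegPr» (stmt-QuantumFields-19200, stub EX, route (α)) — «E2-133»: THE WILSON-HESSIAN ROW OF THE SOLUTION OF (111) AT THE T³
# MEMBER FROM (111) ALONE — `Δx Y = −(Ĵ + Ŵ) + Q_k†(QGQ*)⁻¹Q_kG(Ĵ + Ŵ) + D R_S D* G(Ĵ + Ŵ) + Q_k†((QGQ*)⁻¹ − a)b̃` for `Y = −𝔊(Ĵ + Ŵ) + H b̃` on the class `PosOnto`, and at the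
# slot of record `Δ_π`: `Δ^η Y = (that) + (DG′R_SD*)†(Δ^η Y)` — pure algebra over the landed layer-0 bricks ([Balaban1985BackgroundPropagators] (3.26), (3.122)–(3.126), (3.147),
# (3.153); [Balaban1985Variational] (45), (102)–(103), (110)–(111), (129), (133), (137)); whence the identity row `hEqΔ` of ✓`Prop7HDsolOfRows.secondOrder_of_hessRow` is a THEOREM
# and `hΔsol` ([Balaban1985Variational] (136) + its `D*D` companion) follows from (111) + `RegPr` + `PosOnto ∧ PosPrime` + pointwise sup rows on five NAMED `L²` objects

Cell `ym3-torus` (HUMAN RULING D-0037, YM ladder rung R3 — YM₃ on T³, NOT d = 4, NOT Clay; YM gap NOT proved), width seat `ym3-torus-px16` (explicit-unit; ★w2-19200 g5 (G12)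
«E2-133 LOCATE GO»; LOCATE `LOCATE-E2-133-px16.md` = 19200 evidence 18:39Z, §4).  THEOREMS ONLY (0 `def`, 0 `sorry`); `--supports stmt-QuantumFields-19200 --as helper`, count-neutral;
NO claim on crux∕stub∕registry.

THE PRINT.  [Balaban1985Variational] p. 294 (110)–(111): «We denote by G₁ an inverse operator to the operator Δ₁ + DRD* + aQ*Q … A₁ + 𝔊J + 𝔊((δ∕δA′)V)(A₁ + H₁B) = 0 (111) … the operator
G₁𝔓* is equal to the operator 𝔊»; p. 297 (128)–(129), p. 298 (133) «(Δ + DRD*)A₀ = −P₀*J + P₀*Δ⁽²⁾A′₁ − P₀*((δ∕δA′)V)(A′₁)», (137) «Δ_πH = … = Q*(QGQ*)⁻¹(L^{j(·)}η)⁻¹ − Q*a(L^{j(·)}η)⁻¹».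
[Balaban1985BackgroundPropagators] (3.26)–(3.27) p. 395, (3.119)–(3.126) pp. 419–420, (3.147) p. 425 «𝔓 = I − GQ*(QGQ*)⁻¹Q − GDRD*», (3.153) p. 426 «𝔊 = G𝔓*».

WHY THIS ROUTE (located).  (111) IS the Euler–Lagrange equation of the functional on the slice (102) `ker Q ∩ ker RD*`; reading it through `Δ_aG = 1` and `𝔊 = G𝔓*` gives `Δ_a` of the
solution EXACTLY, with residual in `range Q* + range(DR_S·)`: the `range Q*` part is print's `(1 − P₀*)`-term of (133) plus (129)'s `Δ_aH B̃ = Q*(QGQ*)⁻¹B̃` (★px5 ✓`laplaceA_HT_pi`), the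
`range(DR_S·)` part is the LANDAU-CONSTRAINT MULTIPLIER `DR_SD*G(Ĵ+Ŵ)` — print kills it by (127) (criticality on all of `ker Q`, the (123)–(126) door ✓`Prop7Crit127OfCrit93Split`), here it stays
a displayed first-order term (bounded by [5] (3.42) n = 1 ∕ (3.49) — N06).  No criticality, no (81)∕(84) junction and no ℝ∕ℂ weak-form step are used: everything is an identity of linear maps.

WHAT IS PROVED (member `F`, `h : n ≤ K`, weights `c₀ cB a`, Hessian slot `Δx`, background `U₀`; `Qk† := LinearMap.adjoint (Qk …)`):
* §1 on `hp : PosOnto … Δx U₀`: ★`laplaceA_frakGT` (`Δ_a(𝔊x) = 𝔓*x = x − Qk†(QGQ*)⁻¹QkGx − DR_SD*Gx`), ★`laplaceA_sol` (`Δ_a(−𝔊x + Hb) = −𝔓*x + Qk†(QGQ*)⁻¹b`), and with the Landau guards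
  `hΔ hΔ′` of ✓`RS_DstarL2_frakGT` (discharged at `Δ_π` in §2): `RS_DstarL2_sol` ((102)L+(129)L: `R_SD*Y = 0`), `Qk_sol` ((102)+(129): `Q_kY = b`), ★★`slot_sol_eq` —
  `Δx U₀ Y = −x + Qk†((QGQ*)⁻¹(Qk(Gx))) + D(R_S(D*(Gx))) + Qk†((QGQ*)⁻¹b) − Qk†(a•b)`, `Y := −𝔊x + Hb` ((3.26) unfolded by ✓`laplaceA_apply`).
* §2 at `Δx := DeltaPiSlot` on `PosOnto ∧ PosPrime`: `adjoint_gaugeCorr_apply` (`Pᵀz = z − (DG′R_SD*)†z`), `gaugeCorr_sol` (`PY = Y`), ★★★`DeltaEta_sol_eq` —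
  `Δ^η Y = [RHS of §1] + (DL2 ∘ G′ ∘ R_S ∘ DstarL2)†(Δ^η Y)` (the (138)–(139) letter of ★px5's `h139`, for the solution).
* §3 the knit's reading: `toL2_iota_eq111` — from the knit's (111) `A₁ + 𝒢f J + 𝒢f W = 0` (`𝒢f := frakGfR … Δx U₀`) and the datum `B̃`: `toL2(ι(A₁ + H₁f B̃)) = −𝔊(Ĵ + Ŵ) + H(toL2B B̃)`
  (`Ĵ := funEquiv⁻¹(NegSup.equiv J)`, ✓`iota_frakGfR_eq`, ✓`iota_H1f_eq`); ★★★`secondOrder_of_eq111_rows` — BOTH second-order members of (19) for `ι(A₁ + H₁f B̃)` on `RegPr ε₀ U₀`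
  from (111) + the classes + FIVE pointwise sup rows on the named `L²` objects read back on the carrier (`toL2⁻¹Ĵ` (28), `toL2⁻¹Ŵ` (97), `toL2⁻¹(Qk†((QGQ*)⁻¹ − a)b̃)` (137),
  `toL2⁻¹(Qk†(QGQ*)⁻¹QkG(Ĵ+Ŵ) + DR_SD*G(Ĵ+Ŵ))` ((133)'s `1 − P₀*` + the multiplier), `toL2⁻¹((DG′R_SD*)†Δ^ηY)` (139)) + the (3.49) row `hDPD` for `D(D*Y)`:
  `‖D¹*D¹Y‖ ≤ (sJ + sW + s137 + sC + s139 + 28ε₀·nY)·η²`, `‖Δ¹Y‖ ≤ (that + k₄·nY + 4ε₀·nY)·η²` — via ✓`symm_DeltaEta_toL2_apply`, ✓`norm_deltaPrimeOp_le_of_regPr` (★px5), ✓`Prop7SecondOrderDict`.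
INHABITABILITY (★★OWNER RULING g27-№9 (3)): §1–§3 identities need only `PosOnto`∕`PosPrime` ([5] Thm 3.11 on the regular class — the knit's standing N06 input, ✓`…EXJunctionRowsT3` §2's `hN06`);
the five sup rows are satisfied by `Ĵ = Ŵ = 0`, `B̃ = 0` (then every named object is `0`), and on `RegPr` by: (28) ✓`inU2cur_of_regPr`; (97) the knit's `prop4`; (137) ★px5's `h137` supplier
(`(QGQ*)⁻¹`, `Q†` sup letters); the `P₀*`∕multiplier row = [5] Thm 3.3 n = 0, 1 + (3.49) (N06); (139) = ★px5's `h139` supplier («G′RD* bounded in |·|₍₁₎», p. 299 l. 6); `hDPD` = (3.49) via (21).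

HONEST SCOPE.  Linear algebra over landed letters + one triangle inequality; NO estimate of [5]∕[B11] proved; the rows ARE the content; not a proof of any stub; nothing continuum ∕ OS ∕
mass-gap ∕ Clay.

References: T. Bałaban, CMP **102** (1985) 277–309 [Balaban1985Variational] ((45) p.285, (102)–(103) p.293, (110)–(111) p.294, (128)–(129) p.297, (133)–(137) p.298, (19) p.281);
CMP **99** (1985) 389–434 [Balaban1985BackgroundPropagators] ((3.26)–(3.27) p.395, (3.119)–(3.126) pp.419–420, (3.147) p.425, (3.153) p.426, (3.42) p.397, (3.49) p.399).
-/

set_option autoImplicit false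

noncomputable section

open scoped InnerProductSpace ComplexConjugate Matrix.Norms.L2Operator

namespace Summit.QuantumFields.YangMills.Theorems.Prop7HessRowOfEq111

open Literature.MathematicalPhysics.QuantumFieldTheory.Balaban1983to89
open Literature.MathematicalPhysics.QuantumFieldTheory.Balaban1983to89.T3ContinuumYM3Torus
open Literature.MathematicalPhysics.QuantumFieldTheory.Balaban1983to89.T3PrintedRegularMinimiser (RegPr)
open T3SectALandauChart (eta eta_pos covDerivFwdT formComp covCodiffCurlT covLapFormT covDivFormT bgUnits)
open B9SectCLatticeCarrier (Bond)
open B9Eq311L2Pairing (WL2)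
open B11Eq115Space (NegSize Space115 JetSup NegSup)
open B11Eq111FrakG (nabla115)
open B11Eq103H1Complex (SiteL2K BondL2K funEquiv)
open B9TorusCalculus (torusT)
open B9Eq310Hermitian (deltaPrimeOp)
open Summit.QuantumFields.YangMills.Theorems.Prop7SectET3Transport (periodsT3 bondEquiv bgOfCfg)
open Summit.QuantumFields.YangMills.Theorems.Prop7SectET3HilbertLetters (W₂ frobEquiv toL2 toL2B DL2 DstarL2)
open Summit.QuantumFields.YangMills.Theorems.Prop7SectET3GaugeProjector (NS RS)
open Summit.QuantumFields.YangMills.Theorems.Prop7SectET3WilsonHessian (DeltaEta)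
open Summit.QuantumFields.YangMills.Theorems.Prop7SectET3CurvedPropagators
open Summit.QuantumFields.YangMills.Theorems.Prop7SectET3DeltaPi
open Summit.QuantumFields.YangMills.Theorems.Prop7SectET3H137Rows (laplaceA_HT_pi)
open Summit.QuantumFields.YangMills.Theorems.Prop7SectET3DeltaEtaExplicit (symm_DeltaEta_toL2_apply norm_deltaPrimeOp_le_of_regPr)
open Summit.QuantumFields.YangMills.Theorems.Prop7SecondOrderDict

variable {F : T3Family} {n K : ℕ} {h : n ≤ K} {c₀ cB a : ℝ} [Fact (0 < c₀)] [Fact (0 < cB)]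
  {Δx : GaugeField (F.P K) 0 (Matrix.specialUnitaryGroup (Fin 2) ℂ) → (BondL2K ℂ 3 (periodsT3 F K) c₀ W₂ →ₗ[ℂ] BondL2K ℂ 3 (periodsT3 F K) c₀ W₂)}

/-! ## §1 Generic Hessian slot: `Δ_a` and `Δx` of `Y = −𝔊x + Hb` on the class -/

/-- ★ **`Δ_a(𝔊x) = 𝔓*x`** — `𝔊 = G𝔓*` (3.153) with `Δ_aG = 1`: `Δ_a(𝔊x) = x − Q_k†((QGQ*)⁻¹(Q_k(Gx))) − D(R_S(D*(Gx)))`.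
[cite: Balaban1985BackgroundPropagators, (3.147) p.425, (3.153) p.426, (3.27) p.395; Balaban1985Variational, (110)–(111) p.294] -/
theorem laplaceA_frakGT {U₀ : GaugeField (F.P K) 0 (Matrix.specialUnitaryGroup (Fin 2) ℂ)} (hp : PosOnto F n K h c₀ cB a Δx U₀) (x : BondL2K ℂ 3 (periodsT3 F K) c₀ W₂) :
    laplaceA F n K h c₀ cB a Δx U₀ (frakGT F n K h c₀ cB a Δx U₀ x)
      = x - LinearMap.adjoint (Qk F n K h c₀ cB U₀) (KinvT F n K h c₀ cB a Δx U₀ (Qk F n K h c₀ cB U₀ (GT F n K h c₀ cB a Δx U₀ x)))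
          - DL2 F n K c₀ U₀ (RS F n K h c₀ cB U₀ (DstarL2 F n K c₀ U₀ (GT F n K h c₀ cB a Δx U₀ x))) := by
  simp only [frakGT, B11Eq111FrakG.frakGLin_apply, map_sub, laplaceA_GT hp]

/-- ★ **`Δ_a(−𝔊x + Hb) = −𝔓*x + Q_k†((QGQ*)⁻¹b)`** ((129)'s `Δ_aH = Q*(QGQ*)⁻¹`, ✓`laplaceA_HT_pi`). [cite: Balaban1985Variational, (129) p.297, (133) p.298; Balaban1985BackgroundPropagators, (3.126) p.420] -/
theorem laplaceA_sol {U₀ : GaugeField (F.P K) 0 (Matrix.specialUnitaryGroup (Fin 2) ℂ)} (hp : PosOnto F n K h c₀ cB a Δx U₀) (x : BondL2K ℂ 3 (periodsT3 F K) c₀ W₂)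
    (b : WL2 ℂ (fun _ : PBond (F.P n) 0 => cB) W₂) :
    laplaceA F n K h c₀ cB a Δx U₀ (-(frakGT F n K h c₀ cB a Δx U₀ x) + HT F n K h c₀ cB a Δx U₀ b)
      = -x + LinearMap.adjoint (Qk F n K h c₀ cB U₀) (KinvT F n K h c₀ cB a Δx U₀ (Qk F n K h c₀ cB U₀ (GT F n K h c₀ cB a Δx U₀ x)))
          + DL2 F n K c₀ U₀ (RS F n K h c₀ cB U₀ (DstarL2 F n K c₀ U₀ (GT F n K h c₀ cB a Δx U₀ x)))
          + LinearMap.adjoint (Qk F n K h c₀ cB U₀) (KinvT F n K h c₀ cB a Δx U₀ b) := by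
  rw [map_add, map_neg, laplaceA_frakGT hp, laplaceA_HT_pi hp]
  abel

/-- **(102)L + (129)L for the solution: `R_S(D*Y) = 0`**, `Y = −𝔊x + Hb`. [cite: Balaban1985Variational, (102) p.293, (129) p.297; Balaban1985BackgroundPropagators, (3.124) p.420] -/
theorem RS_DstarL2_sol {U₀ : GaugeField (F.P K) 0 (Matrix.specialUnitaryGroup (Fin 2) ℂ)} (hp : PosOnto F n K h c₀ cB a Δx U₀)
    (hΔ : ∀ l ∈ NS F n K h c₀ cB U₀, Δx U₀ (DL2 F n K c₀ U₀ l) = 0) (hΔ' : ∀ l ∈ NS F n K h c₀ cB U₀, ∀ w, ⟪DL2 F n K c₀ U₀ l, Δx U₀ w⟫_ℂ = 0)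
    (x : BondL2K ℂ 3 (periodsT3 F K) c₀ W₂) (b : WL2 ℂ (fun _ : PBond (F.P n) 0 => cB) W₂) :
    RS F n K h c₀ cB U₀ (DstarL2 F n K c₀ U₀ (-(frakGT F n K h c₀ cB a Δx U₀ x) + HT F n K h c₀ cB a Δx U₀ b)) = 0 := by
  rw [map_add, map_neg, map_add, map_neg, RS_DstarL2_frakGT hp hΔ hΔ' x, RS_DstarL2_HT hp hΔ' b, neg_zero, zero_add]

/-- **(102) + (129)∕(45) for the solution: `Q_kY = b`**. [cite: Balaban1985Variational, (102) p.293, (45) p.285, (129) p.297] -/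
theorem Qk_sol {U₀ : GaugeField (F.P K) 0 (Matrix.specialUnitaryGroup (Fin 2) ℂ)} (hp : PosOnto F n K h c₀ cB a Δx U₀)
    (hΔ : ∀ l ∈ NS F n K h c₀ cB U₀, Δx U₀ (DL2 F n K c₀ U₀ l) = 0)
    (x : BondL2K ℂ 3 (periodsT3 F K) c₀ W₂) (b : WL2 ℂ (fun _ : PBond (F.P n) 0 => cB) W₂) :
    Qk F n K h c₀ cB U₀ (-(frakGT F n K h c₀ cB a Δx U₀ x) + HT F n K h c₀ cB a Δx U₀ b) = b := by
  rw [map_add, map_neg, Qk_frakGT hp hΔ x, Qk_HT hp b, neg_zero, zero_add]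

/-- ★★ **THE HESSIAN-SLOT ROW OF THE SOLUTION FROM (111) ALONE**: on the class, with the two Landau guards of the slot,
`Δx U₀ Y = −x + Q_k†((QGQ*)⁻¹(Q_k(Gx))) + D(R_S(D*(Gx))) + Q_k†((QGQ*)⁻¹b) − Q_k†(a • b)` for `Y = −𝔊x + Hb` — (133)'s `−P₀*x` (first two terms), the LANDAU MULTIPLIER (third), (137)'s block
letter (last two); by (3.26) `Δ_a = Δx + DR_SD* + Q*aQ` (✓`laplaceA_apply`) with `R_SD*Y = 0`, `Q_kY = b`. [cite: Balaban1985Variational, (111) p.294, (133) p.298, (137) p.298; Balaban1985BackgroundPropagators, (3.26) p.395, (3.153) p.426] -/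
theorem slot_sol_eq {U₀ : GaugeField (F.P K) 0 (Matrix.specialUnitaryGroup (Fin 2) ℂ)} (hp : PosOnto F n K h c₀ cB a Δx U₀)
    (hΔ : ∀ l ∈ NS F n K h c₀ cB U₀, Δx U₀ (DL2 F n K c₀ U₀ l) = 0) (hΔ' : ∀ l ∈ NS F n K h c₀ cB U₀, ∀ w, ⟪DL2 F n K c₀ U₀ l, Δx U₀ w⟫_ℂ = 0)
    (x : BondL2K ℂ 3 (periodsT3 F K) c₀ W₂) (b : WL2 ℂ (fun _ : PBond (F.P n) 0 => cB) W₂) :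
    Δx U₀ (-(frakGT F n K h c₀ cB a Δx U₀ x) + HT F n K h c₀ cB a Δx U₀ b)
      = -x + LinearMap.adjoint (Qk F n K h c₀ cB U₀) (KinvT F n K h c₀ cB a Δx U₀ (Qk F n K h c₀ cB U₀ (GT F n K h c₀ cB a Δx U₀ x)))
          + DL2 F n K c₀ U₀ (RS F n K h c₀ cB U₀ (DstarL2 F n K c₀ U₀ (GT F n K h c₀ cB a Δx U₀ x)))
          + LinearMap.adjoint (Qk F n K h c₀ cB U₀) (KinvT F n K h c₀ cB a Δx U₀ b)
          - LinearMap.adjoint (Qk F n K h c₀ cB U₀) (((a : ℂ)) • b) := by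
  have h1 := laplaceA_sol hp x b
  rw [laplaceA_apply, RS_DstarL2_sol hp hΔ hΔ' x b, Qk_sol hp hΔ x b, map_zero, add_zero] at h1
  rw [← h1, add_sub_cancel_right]

/-! ## §2 The slot of record `Δ_π`: the Wilson Hessian `Δ^η` of the solution -/

/-- `Pᵀz = z − (DG′R_SD*)†z` for `P = gaugeCorr = 1 − DG′R_SD*` ((3.119)). [cite: Balaban1985BackgroundPropagators, (3.119) p.419] -/
theorem adjoint_gaugeCorr_apply (U₀ : GaugeField (F.P K) 0 (Matrix.specialUnitaryGroup (Fin 2) ℂ)) (z : BondL2K ℂ 3 (periodsT3 F K) c₀ W₂) :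
    LinearMap.adjoint (gaugeCorr F n K h c₀ cB a U₀) z
      = z - LinearMap.adjoint (DL2 F n K c₀ U₀ ∘ₗ GprimeT F n K h c₀ cB a U₀ ∘ₗ RS F n K h c₀ cB U₀ ∘ₗ DstarL2 F n K c₀ U₀) z := by
  have hg : gaugeCorr F n K h c₀ cB a U₀ = LinearMap.id - (DL2 F n K c₀ U₀ ∘ₗ GprimeT F n K h c₀ cB a U₀ ∘ₗ RS F n K h c₀ cB U₀ ∘ₗ DstarL2 F n K c₀ U₀) := by
    apply LinearMap.ext
    intro A
    rw [gaugeCorr_apply]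
    rfl
  rw [hg, map_sub, LinearMap.sub_apply]
  congr 1
  refine ext_inner_right ℂ fun w => ?_
  rw [LinearMap.adjoint_inner_left, LinearMap.id_apply]

/-- For the solution `Y = −𝔊x + Hb` at the slot of record, `PY = Y` (its Landau member). [cite: Balaban1985BackgroundPropagators, (3.119) p.419; Balaban1985Variational, (102) p.293, (129) p.297] -/
theorem gaugeCorr_sol {U₀ : GaugeField (F.P K) 0 (Matrix.specialUnitaryGroup (Fin 2) ℂ)} (hp : PosOnto F n K h c₀ cB a (DeltaPiSlot F n K h c₀ cB a) U₀)
    (hq : PosPrime F n K h c₀ cB a U₀) (x : BondL2K ℂ 3 (periodsT3 F K) c₀ W₂) (b : WL2 ℂ (fun _ : PBond (F.P n) 0 => cB) W₂) :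
    gaugeCorr F n K h c₀ cB a U₀ (-(frakGT F n K h c₀ cB a (DeltaPiSlot F n K h c₀ cB a) U₀ x) + HT F n K h c₀ cB a (DeltaPiSlot F n K h c₀ cB a) U₀ b)
      = -(frakGT F n K h c₀ cB a (DeltaPiSlot F n K h c₀ cB a) U₀ x) + HT F n K h c₀ cB a (DeltaPiSlot F n K h c₀ cB a) U₀ b := by
  rw [gaugeCorr_apply, RS_DstarL2_sol hp (DeltaPiSlot_kills_NS hq) (inner_DL2_DeltaPi_eq_zero hq) x b, map_zero, map_zero, sub_zero]

/-- ★★★ **THE WILSON-HESSIAN ROW OF THE SOLUTION OF (111), SLOT OF RECORD `Δ_π`** («E2-133»): on `PosOnto ∧ PosPrime`, for `Y = −𝔊x + Hb`,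
`Δ^η Y = −x + Q_k†((QGQ*)⁻¹(Q_k(Gx))) + D(R_S(D*(Gx))) + Q_k†((QGQ*)⁻¹b) − Q_k†(a • b) + (D ∘ G′ ∘ R_S ∘ D*)†(Δ^η Y)` — the last term is print's (138)–(139) letter.
[cite: Balaban1985Variational, (111) p.294, (133) p.298, (137)–(139) pp.298–299; Balaban1985BackgroundPropagators, (3.119) p.419, (3.122)–(3.126) p.420] -/
theorem DeltaEta_sol_eq {U₀ : GaugeField (F.P K) 0 (Matrix.specialUnitaryGroup (Fin 2) ℂ)} (hp : PosOnto F n K h c₀ cB a (DeltaPiSlot F n K h c₀ cB a) U₀)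
    (hq : PosPrime F n K h c₀ cB a U₀) (x : BondL2K ℂ 3 (periodsT3 F K) c₀ W₂) (b : WL2 ℂ (fun _ : PBond (F.P n) 0 => cB) W₂) :
    DeltaEta F n K c₀ U₀ (-(frakGT F n K h c₀ cB a (DeltaPiSlot F n K h c₀ cB a) U₀ x) + HT F n K h c₀ cB a (DeltaPiSlot F n K h c₀ cB a) U₀ b)
      = (-x + LinearMap.adjoint (Qk F n K h c₀ cB U₀) (KinvT F n K h c₀ cB a (DeltaPiSlot F n K h c₀ cB a) U₀ (Qk F n K h c₀ cB U₀ (GT F n K h c₀ cB a (DeltaPiSlot F n K h c₀ cB a) U₀ x)))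
          + DL2 F n K c₀ U₀ (RS F n K h c₀ cB U₀ (DstarL2 F n K c₀ U₀ (GT F n K h c₀ cB a (DeltaPiSlot F n K h c₀ cB a) U₀ x)))
          + LinearMap.adjoint (Qk F n K h c₀ cB U₀) (KinvT F n K h c₀ cB a (DeltaPiSlot F n K h c₀ cB a) U₀ b)
          - LinearMap.adjoint (Qk F n K h c₀ cB U₀) (((a : ℂ)) • b))
        + LinearMap.adjoint (DL2 F n K c₀ U₀ ∘ₗ GprimeT F n K h c₀ cB a U₀ ∘ₗ RS F n K h c₀ cB U₀ ∘ₗ DstarL2 F n K c₀ U₀)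
            (DeltaEta F n K c₀ U₀ (-(frakGT F n K h c₀ cB a (DeltaPiSlot F n K h c₀ cB a) U₀ x) + HT F n K h c₀ cB a (DeltaPiSlot F n K h c₀ cB a) U₀ b)) := by
  have h1 := slot_sol_eq hp (DeltaPiSlot_kills_NS hq) (inner_DL2_DeltaPi_eq_zero hq) x b
  rw [DeltaPiSlot_apply, DeltaPi_apply, gaugeCorr_sol hp hq, adjoint_gaugeCorr_apply] at h1
  rw [← h1, sub_add_cancel]

/-! ## §3 The knit's reading: (111) in the EX letters ⟹ `toL2(ι(A₁ + H₁fB̃)) = −𝔊(Ĵ + Ŵ) + H b̃`, and `hΔsol` from named rows -/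

section Knit

variable [Fact (0 < (F.L : ℝ))] [Fact (0 < ((F.L : ℝ)⁻¹) ^ (K - n))]

/-- **THE KNIT'S (111) READ IN `L²`**: if `A₁ + 𝒢f J + 𝒢f W = 0` with `𝒢f := frakGfR … Δx U₀` (the EX knit's hypothesis text, `W` standing for `Wf(A₁ + H₁fB̃)`), then the (115)-reading on the
route carrier of `A₁ + H₁f B̃` is, in `L²`, `−𝔊(Ĵ + Ŵ) + H(toL2B B̃)` with `Ĵ := funEquiv⁻¹(NegSup.equiv J)` (✓`iota_frakGfR_eq`, ✓`iota_H1f_eq`).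
[cite: Balaban1985Variational, (103) p.293, (111) p.294] -/
theorem toL2_iota_eq111 (U₀ : GaugeField (F.P K) 0 (Matrix.specialUnitaryGroup (Fin 2) ℂ))
    (A₁ : Space115 (F.L : ℝ) (((F.L : ℝ)⁻¹) ^ (K - n)) (fun _ : Bond 3 (periodsT3 F K) => K - n) (fun _ : Bond 3 (periodsT3 F K) × Fin 3 => K - n)
      (nabla115 (((F.L : ℝ)⁻¹) ^ (K - n)) (bgOfCfg F K U₀)))
    (J W : NegSize (F.L : ℝ) (((F.L : ℝ)⁻¹) ^ (K - n)) (fun _ : Bond 3 (periodsT3 F K) => K - n) 3 (Matrix (Fin 2) (Fin 2) ℂ))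
    (B : PBond (F.P n) 0 → Matrix (Fin 2) (Fin 2) ℂ)
    (heq : A₁ + frakGfR F n K h c₀ cB a Δx U₀ J + frakGfR F n K h c₀ cB a Δx U₀ W = 0) :
    toL2 F K c₀ (fun b : PBond (F.P K) 0 => JetSup.equiv _ _ _ (A₁ + H1f F n K h c₀ cB a Δx U₀ B) (bondEquiv F K b))
      = -(frakGT F n K h c₀ cB a Δx U₀ ((funEquiv frobEquiv (fun _ : Bond 3 (periodsT3 F K) => c₀)).symm (NegSup.equiv _ _ J + NegSup.equiv _ _ W)))
        + HT F n K h c₀ cB a Δx U₀ (toL2B F n cB B) := by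
  have hA : A₁ = -(frakGfR F n K h c₀ cB a Δx U₀ J + frakGfR F n K h c₀ cB a Δx U₀ W) := by
    rw [add_assoc] at heq
    exact eq_neg_of_add_eq_zero_left heq
  have hfun : (fun b : PBond (F.P K) 0 => JetSup.equiv _ _ _ (A₁ + H1f F n K h c₀ cB a Δx U₀ B) (bondEquiv F K b))
      = -((fun b : PBond (F.P K) 0 => JetSup.equiv _ _ _ (frakGfR F n K h c₀ cB a Δx U₀ J) (bondEquiv F K b))
          + (fun b : PBond (F.P K) 0 => JetSup.equiv _ _ _ (frakGfR F n K h c₀ cB a Δx U₀ W) (bondEquiv F K b)))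
        + (fun b : PBond (F.P K) 0 => JetSup.equiv _ _ _ (H1f F n K h c₀ cB a Δx U₀ B) (bondEquiv F K b)) := by
    funext b
    rw [hA]
    rfl
  rw [hfun, iota_frakGfR_eq, iota_frakGfR_eq, iota_H1f_eq, map_add, map_neg, map_add, LinearEquiv.apply_symm_apply, LinearEquiv.apply_symm_apply,
    LinearEquiv.apply_symm_apply, ← map_add, ← map_add]

end Knit

/-- **READBACK OF A WILSON-HESSIAN ROW** (generic, the analytic step): if `Δ^η(toL2 Yf) = Z` with a pointwise sup row `‖toL2⁻¹Z‖ ≤ sZ`, then on `RegPr ε₀ U₀` BOTH second-order members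
of (19) for `Yf` are bounded — `‖D¹*D¹Yf‖ ≤ (sZ + 28ε₀·nY)·η²` (Δ310-EXPLICIT ✓`symm_DeltaEta_toL2_apply` + ✓`norm_deltaPrimeOp_le_of_regPr`) and, with the (3.49) row `hDPD` for `D¹(D¹*Yf)`,
`‖Δ¹Yf‖ ≤ (sZ + 28ε₀·nY + k₄·nY + 4ε₀·nY)·η²` ((135) + (14), ✓`Prop7SecondOrderDict`). [cite: Balaban1985Variational, (19) p.281, (135)–(136) p.298; Balaban1985BackgroundPropagators, (3.10) p.392, (3.49) p.399] -/
theorem secondOrder_of_DeltaEta_row {ε₀ : ℝ} {U₀ : GaugeField (F.P K) 0 (Matrix.specialUnitaryGroup (Fin 2) ℂ)} (hU₀ : RegPr F n K ε₀ U₀)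
    (Yf : PBond (F.P K) 0 → Matrix (Fin 2) (Fin 2) ℂ) (Z : BondL2K ℂ 3 (periodsT3 F K) c₀ W₂) (hZ : DeltaEta F n K c₀ U₀ (toL2 F K c₀ Yf) = Z)
    {nY sZ k₄ : ℝ} (hYsup : ∀ bd, ‖Yf bd‖ ≤ nY) (hZsup : ∀ bd, ‖(toL2 F K c₀).symm Z bd‖ ≤ sZ)
    (hDPD : ∀ μ y, ‖covDerivFwdT 1 (bgUnits F K U₀) μ (covDivFormT 1 (bgUnits F K U₀) Yf) y‖ ≤ k₄ * nY * eta F n K ^ 2) :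
    (∀ (μ : Fin (F.P K).d) (y : Site (F.P K) 0), ‖covCodiffCurlT 1 (bgUnits F K U₀) Yf μ y‖ ≤ (sZ + 28 * ε₀ * nY) * eta F n K ^ 2) ∧
    (∀ (ν : Fin (F.P K).d) (y : Site (F.P K) 0), ‖covLapFormT 1 (bgUnits F K U₀) Yf ν y‖ ≤ (sZ + 28 * ε₀ * nY + k₄ * nY + 4 * ε₀ * nY) * eta F n K ^ 2) := by
  have hη : 0 < eta F n K := eta_pos F n K
  have hη2 : 0 ≤ eta F n K ^ 2 := sq_nonneg _
  have hread : ∀ bd : PBond (F.P K) 0,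
      covCodiffCurlT 1 (bgUnits F K U₀) Yf bd.dir bd.src
        + deltaPrimeOp (torusT (F.P K) 0) (fun μ y => bgUnits F K U₀ ⟨y, μ⟩) 1 (formComp Yf) bd.dir bd.src
        = (((eta F n K) ^ 2 : ℝ) : ℂ) • (toL2 F K c₀).symm Z bd := by
    intro bd
    rw [← hZ, symm_DeltaEta_toL2_apply, smul_smul]
    have hc : ((((eta F n K) ^ 2 : ℝ) : ℂ)) * ((((eta F n K)⁻¹ ^ 2 : ℝ) : ℂ)) = 1 := by
      rw [← Complex.ofReal_mul, ← mul_pow, mul_inv_cancel₀ hη.ne', one_pow, Complex.ofReal_one]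
    rw [hc, one_smul]
  have hΔp : ∀ μ y, ‖deltaPrimeOp (torusT (F.P K) 0) (fun μ y => bgUnits F K U₀ ⟨y, μ⟩) 1 (formComp Yf) μ y‖ ≤ 28 * (ε₀ * eta F n K ^ 2) * nY :=
    fun μ y => norm_deltaPrimeOp_le_of_regPr U₀ hU₀ hYsup μ y
  have hDD : ∀ (μ : Fin (F.P K).d) (y : Site (F.P K) 0), ‖covCodiffCurlT 1 (bgUnits F K U₀) Yf μ y‖ ≤ (sZ + 28 * ε₀ * nY) * eta F n K ^ 2 := by
    intro μ y
    have h1 := hread ⟨y, μ⟩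
    have h2 : covCodiffCurlT 1 (bgUnits F K U₀) Yf μ y
        = (((eta F n K) ^ 2 : ℝ) : ℂ) • (toL2 F K c₀).symm Z ⟨y, μ⟩
          - deltaPrimeOp (torusT (F.P K) 0) (fun μ y => bgUnits F K U₀ ⟨y, μ⟩) 1 (formComp Yf) μ y := by
      rw [← h1]; exact (add_sub_cancel_right _ _).symm
    rw [h2]
    refine (norm_sub_le _ _).trans ?_
    rw [norm_smul, Complex.norm_real, Real.norm_of_nonneg hη2]
    have e1 := mul_le_mul_of_nonneg_left (hZsup ⟨y, μ⟩) hη2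
    have e2 := hΔp μ y
    have : eta F n K ^ 2 * sZ + 28 * (ε₀ * eta F n K ^ 2) * nY = (sZ + 28 * ε₀ * nY) * eta F n K ^ 2 := by ring
    linarith
  refine ⟨hDD, fun ν y => ?_⟩
  have hK : ‖B11Eq135Weitzenbock.curvOp (torusT (F.P K) 0) (fun μ y => bgUnits F K U₀ ⟨y, μ⟩) (formComp Yf) ν y‖ ≤ 2 * (((F.P K).d : ℝ) - 1) * (ε₀ * eta F n K ^ 2) * nY := by
    have h0 := norm_curvOp_formComp_le (bgUnits F K U₀) (norm_bgUnits_le_one F K U₀) (norm_plaqFT_bgUnits_sub_one_le F K U₀ hU₀.plaqSmall) hYsup ν y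
    have hreg : T3RegularMinimiser.regThreshold F n K ε₀ = ε₀ * eta F n K ^ 2 := by
      rw [T3RegularMinimiser.regThreshold, eta, ← pow_mul, mul_comm 2 (K - n)]
    rwa [hreg] at h0
  have hd : (((F.P K).d : ℝ) - 1) = 2 := by rw [T3Family.P_d]; norm_num
  rw [hd] at hK
  rw [covLapFormT_eq_covCodiffCurlT_add]
  have h1 := hDD ν y
  have h2 := hDPD ν y
  have h3 : ‖covCodiffCurlT 1 (bgUnits F K U₀) Yf ν y + covDerivFwdT 1 (bgUnits F K U₀) ν (covDivFormT 1 (bgUnits F K U₀) Yf) y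
        + B11Eq135Weitzenbock.curvOp (torusT (F.P K) 0) (fun μ y => bgUnits F K U₀ ⟨y, μ⟩) (formComp Yf) ν y‖
      ≤ ‖covCodiffCurlT 1 (bgUnits F K U₀) Yf ν y‖ + ‖covDerivFwdT 1 (bgUnits F K U₀) ν (covDivFormT 1 (bgUnits F K U₀) Yf) y‖
        + ‖B11Eq135Weitzenbock.curvOp (torusT (F.P K) 0) (fun μ y => bgUnits F K U₀ ⟨y, μ⟩) (formComp Yf) ν y‖ := norm_add₃_le
  have : (sZ + 28 * ε₀ * nY) * eta F n K ^ 2 + k₄ * nY * eta F n K ^ 2 + 2 * 2 * (ε₀ * eta F n K ^ 2) * nY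
      = (sZ + 28 * ε₀ * nY + k₄ * nY + 4 * ε₀ * nY) * eta F n K ^ 2 := by ring
  linarith

/-- **The sup row of the (111)-right side from its four named pieces** (pointwise triangle inequality; `fx fC f137 f139` are the readbacks `toL2⁻¹` of `x = Ĵ + Ŵ`, of the `(1 − P₀*)` +
multiplier term, of (137)'s block letter and of the (139) letter). [cite: Balaban1985Variational, (133) p.298, (137)–(139) pp.298–299] -/
theorem norm_rhs_le (fx fC f137 f139 : PBond (F.P K) 0 → Matrix (Fin 2) (Fin 2) ℂ) {sx sC s137 s139 : ℝ}
    (hx : ∀ bd, ‖fx bd‖ ≤ sx) (hC : ∀ bd, ‖fC bd‖ ≤ sC) (h137 : ∀ bd, ‖f137 bd‖ ≤ s137) (h139 : ∀ bd, ‖f139 bd‖ ≤ s139) (bd : PBond (F.P K) 0) :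
    ‖(-fx + fC + f137 + f139) bd‖ ≤ sx + sC + s137 + s139 := by
  simp only [Pi.add_apply, Pi.neg_apply]
  calc ‖-fx bd + fC bd + f137 bd + f139 bd‖ ≤ ‖-fx bd‖ + ‖fC bd‖ + ‖f137 bd‖ + ‖f139 bd‖ :=
        (norm_add_le _ _).trans (add_le_add ((norm_add₃_le).trans le_rfl) le_rfl)
    _ ≤ sx + sC + s137 + s139 := by rw [norm_neg]; exact add_le_add (add_le_add (add_le_add (hx bd) (hC bd)) (h137 bd)) (h139 bd)

set_option maxHeartbeats 400000 in
-- HEARTBEAT rule (README): the statement carries the member's full letter terms (`LinearMap.adjoint (Qk …)`, `KinvT`, `GT`, `frakGT`, `HT`, `GprimeT`); measured > 200k at elaboration.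
/-- ★★★ **`hΔsol` FROM (111) AND NAMED ROWS** — BOTH second-order members of (19)∕`nMax19` for a route-carrier field `Yf` whose `L²` image is the solution combination `−𝔊x + Hb` at the slot
of record (for the knit: `Yf := ι(A₁ + H₁fB̃)`, `x := Ĵ + Ŵ`, `b := toL2B B̃`, by `toL2_iota_eq111`), on `RegPr ε₀ U₀ ∧ PosOnto ∧ PosPrime`, from FOUR pointwise sup rows on the named `L²` objects
read back on the carrier — `x` ((28)+(97)), the `(1 − P₀*)` + Landau-multiplier term ([5] Thm 3.3 n = 0,1 ∕ (3.49)), (137)'s block letter (★px5 `h137`), the (139) letter (★px5 `h139`) — and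
the (3.49) row `hDPD`: `‖D¹*D¹Yf‖ ≤ (sx + sC + s137 + s139 + 28ε₀·nY)·η²`, `‖Δ¹Yf‖ ≤ (… + k₄·nY + 4ε₀·nY)·η²`.  NO identity row is left.
[cite: Balaban1985Variational, (111) p.294, (133)–(137) p.298, (139) p.299, (19) p.281; Balaban1985BackgroundPropagators, (3.10) p.392, (3.49) p.399, (3.119)–(3.126) pp.419–420] -/
theorem secondOrder_of_eq111_rows {ε₀ : ℝ} {U₀ : GaugeField (F.P K) 0 (Matrix.specialUnitaryGroup (Fin 2) ℂ)} (hU₀ : RegPr F n K ε₀ U₀)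
    (hp : PosOnto F n K h c₀ cB a (DeltaPiSlot F n K h c₀ cB a) U₀) (hq : PosPrime F n K h c₀ cB a U₀)
    (x : BondL2K ℂ 3 (periodsT3 F K) c₀ W₂) (b : WL2 ℂ (fun _ : PBond (F.P n) 0 => cB) W₂) (Yf : PBond (F.P K) 0 → Matrix (Fin 2) (Fin 2) ℂ)
    (hY : toL2 F K c₀ Yf = -(frakGT F n K h c₀ cB a (DeltaPiSlot F n K h c₀ cB a) U₀ x) + HT F n K h c₀ cB a (DeltaPiSlot F n K h c₀ cB a) U₀ b)
    {nY sx sC s137 s139 k₄ : ℝ} (hYsup : ∀ bd, ‖Yf bd‖ ≤ nY)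
    (hx : ∀ bd, ‖(toL2 F K c₀).symm x bd‖ ≤ sx)
    (hC : ∀ bd, ‖(toL2 F K c₀).symm (LinearMap.adjoint (Qk F n K h c₀ cB U₀) (KinvT F n K h c₀ cB a (DeltaPiSlot F n K h c₀ cB a) U₀
        (Qk F n K h c₀ cB U₀ (GT F n K h c₀ cB a (DeltaPiSlot F n K h c₀ cB a) U₀ x)))
        + DL2 F n K c₀ U₀ (RS F n K h c₀ cB U₀ (DstarL2 F n K c₀ U₀ (GT F n K h c₀ cB a (DeltaPiSlot F n K h c₀ cB a) U₀ x)))) bd‖ ≤ sC)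
    (h137 : ∀ bd, ‖(toL2 F K c₀).symm (LinearMap.adjoint (Qk F n K h c₀ cB U₀) (KinvT F n K h c₀ cB a (DeltaPiSlot F n K h c₀ cB a) U₀ b)
        - LinearMap.adjoint (Qk F n K h c₀ cB U₀) (((a : ℂ)) • b)) bd‖ ≤ s137)
    (h139 : ∀ bd, ‖(toL2 F K c₀).symm (LinearMap.adjoint (DL2 F n K c₀ U₀ ∘ₗ GprimeT F n K h c₀ cB a U₀ ∘ₗ RS F n K h c₀ cB U₀ ∘ₗ DstarL2 F n K c₀ U₀)
        (DeltaEta F n K c₀ U₀ (toL2 F K c₀ Yf))) bd‖ ≤ s139)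
    (hDPD : ∀ μ y, ‖covDerivFwdT 1 (bgUnits F K U₀) μ (covDivFormT 1 (bgUnits F K U₀) Yf) y‖ ≤ k₄ * nY * eta F n K ^ 2) :
    (∀ (μ : Fin (F.P K).d) (y : Site (F.P K) 0), ‖covCodiffCurlT 1 (bgUnits F K U₀) Yf μ y‖ ≤ (sx + sC + s137 + s139 + 28 * ε₀ * nY) * eta F n K ^ 2) ∧
    (∀ (ν : Fin (F.P K).d) (y : Site (F.P K) 0),
      ‖covLapFormT 1 (bgUnits F K U₀) Yf ν y‖ ≤ (sx + sC + s137 + s139 + 28 * ε₀ * nY + k₄ * nY + 4 * ε₀ * nY) * eta F n K ^ 2) := by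
  have hΔ := DeltaEta_sol_eq hp hq x b
  rw [← hY] at hΔ
  refine secondOrder_of_DeltaEta_row hU₀ Yf _ hΔ hYsup (fun bd => ?_) hDPD
  -- `toL2⁻¹` of the right side = `−fx + fC + f137 + f139` pointwise
  have hsplit : (toL2 F K c₀).symm
      ((-x + LinearMap.adjoint (Qk F n K h c₀ cB U₀) (KinvT F n K h c₀ cB a (DeltaPiSlot F n K h c₀ cB a) U₀
            (Qk F n K h c₀ cB U₀ (GT F n K h c₀ cB a (DeltaPiSlot F n K h c₀ cB a) U₀ x)))
          + DL2 F n K c₀ U₀ (RS F n K h c₀ cB U₀ (DstarL2 F n K c₀ U₀ (GT F n K h c₀ cB a (DeltaPiSlot F n K h c₀ cB a) U₀ x)))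
          + LinearMap.adjoint (Qk F n K h c₀ cB U₀) (KinvT F n K h c₀ cB a (DeltaPiSlot F n K h c₀ cB a) U₀ b)
          - LinearMap.adjoint (Qk F n K h c₀ cB U₀) (((a : ℂ)) • b))
        + LinearMap.adjoint (DL2 F n K c₀ U₀ ∘ₗ GprimeT F n K h c₀ cB a U₀ ∘ₗ RS F n K h c₀ cB U₀ ∘ₗ DstarL2 F n K c₀ U₀) (DeltaEta F n K c₀ U₀ (toL2 F K c₀ Yf)))
      = -(toL2 F K c₀).symm x
        + (toL2 F K c₀).symm (LinearMap.adjoint (Qk F n K h c₀ cB U₀) (KinvT F n K h c₀ cB a (DeltaPiSlot F n K h c₀ cB a) U₀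
            (Qk F n K h c₀ cB U₀ (GT F n K h c₀ cB a (DeltaPiSlot F n K h c₀ cB a) U₀ x)))
            + DL2 F n K c₀ U₀ (RS F n K h c₀ cB U₀ (DstarL2 F n K c₀ U₀ (GT F n K h c₀ cB a (DeltaPiSlot F n K h c₀ cB a) U₀ x))))
        + (toL2 F K c₀).symm (LinearMap.adjoint (Qk F n K h c₀ cB U₀) (KinvT F n K h c₀ cB a (DeltaPiSlot F n K h c₀ cB a) U₀ b)
            - LinearMap.adjoint (Qk F n K h c₀ cB U₀) (((a : ℂ)) • b))
        + (toL2 F K c₀).symm (LinearMap.adjoint (DL2 F n K c₀ U₀ ∘ₗ GprimeT F n K h c₀ cB a U₀ ∘ₗ RS F n K h c₀ cB U₀ ∘ₗ DstarL2 F n K c₀ U₀)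
            (DeltaEta F n K c₀ U₀ (toL2 F K c₀ Yf))) := by
    simp only [map_add, map_sub, map_neg]
    abel
  rw [hsplit]
  exact norm_rhs_le _ _ _ _ hx hC h137 h139 bd

/-- ★★★ **THE JUNCTION CURRENCY** (★w2-19200 g5 (G13): «`≤ MΔ·ρ·η²`, `ρ = (F.L)^3·(3·F.L)·ε₁` = the `RegPr` radius»): if the four sup rows and the size of `Yf` are `ρ`-SMALL — `sx ≤ cx·ρ`,
`sC ≤ cC·ρ`, `s137 ≤ c137·ρ`, `s139 ≤ c139·ρ`, `nY ≤ B₁∕2·ρ` — and `ρ ≤ 1`, then both second-order members of (19) for `Yf` are `≤ MΔ·ρ·η²` with the EXPLICIT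
`MΔ := cx + cC + c137 + c139 + 14B₁ + k₄B₁∕2 + 2B₁` (print's «ε₂ = O(1)·C₁B₃ε₁» at second order, O(1) through the row constants — G-B11-05).
[cite: Balaban1985Variational, (136) p.298, p.299 ll.16–21, (19) p.281] -/
theorem secondOrder_of_eq111_rows_rho {ρ : ℝ} (hρ : 0 ≤ ρ) (hρ1 : ρ ≤ 1) {U₀ : GaugeField (F.P K) 0 (Matrix.specialUnitaryGroup (Fin 2) ℂ)} (hU₀ : RegPr F n K ρ U₀)
    (hp : PosOnto F n K h c₀ cB a (DeltaPiSlot F n K h c₀ cB a) U₀) (hq : PosPrime F n K h c₀ cB a U₀)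
    (x : BondL2K ℂ 3 (periodsT3 F K) c₀ W₂) (b : WL2 ℂ (fun _ : PBond (F.P n) 0 => cB) W₂) (Yf : PBond (F.P K) 0 → Matrix (Fin 2) (Fin 2) ℂ)
    (hY : toL2 F K c₀ Yf = -(frakGT F n K h c₀ cB a (DeltaPiSlot F n K h c₀ cB a) U₀ x) + HT F n K h c₀ cB a (DeltaPiSlot F n K h c₀ cB a) U₀ b)
    {nY sx sC s137 s139 k₄ cx cC c137 c139 B₁ : ℝ} (hk₄ : 0 ≤ k₄) (hYsup : ∀ bd, ‖Yf bd‖ ≤ nY) (hnY : nY ≤ B₁ / 2 * ρ)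
    (hx : ∀ bd, ‖(toL2 F K c₀).symm x bd‖ ≤ sx) (hsx : sx ≤ cx * ρ)
    (hC : ∀ bd, ‖(toL2 F K c₀).symm (LinearMap.adjoint (Qk F n K h c₀ cB U₀) (KinvT F n K h c₀ cB a (DeltaPiSlot F n K h c₀ cB a) U₀
        (Qk F n K h c₀ cB U₀ (GT F n K h c₀ cB a (DeltaPiSlot F n K h c₀ cB a) U₀ x)))
        + DL2 F n K c₀ U₀ (RS F n K h c₀ cB U₀ (DstarL2 F n K c₀ U₀ (GT F n K h c₀ cB a (DeltaPiSlot F n K h c₀ cB a) U₀ x)))) bd‖ ≤ sC) (hsC : sC ≤ cC * ρ)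
    (h137 : ∀ bd, ‖(toL2 F K c₀).symm (LinearMap.adjoint (Qk F n K h c₀ cB U₀) (KinvT F n K h c₀ cB a (DeltaPiSlot F n K h c₀ cB a) U₀ b)
        - LinearMap.adjoint (Qk F n K h c₀ cB U₀) (((a : ℂ)) • b)) bd‖ ≤ s137) (hs137 : s137 ≤ c137 * ρ)
    (h139 : ∀ bd, ‖(toL2 F K c₀).symm (LinearMap.adjoint (DL2 F n K c₀ U₀ ∘ₗ GprimeT F n K h c₀ cB a U₀ ∘ₗ RS F n K h c₀ cB U₀ ∘ₗ DstarL2 F n K c₀ U₀)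
        (DeltaEta F n K c₀ U₀ (toL2 F K c₀ Yf))) bd‖ ≤ s139) (hs139 : s139 ≤ c139 * ρ)
    (hDPD : ∀ μ y, ‖covDerivFwdT 1 (bgUnits F K U₀) μ (covDivFormT 1 (bgUnits F K U₀) Yf) y‖ ≤ k₄ * nY * eta F n K ^ 2) :
    (∀ (μ : Fin (F.P K).d) (y : Site (F.P K) 0), ‖covCodiffCurlT 1 (bgUnits F K U₀) Yf μ y‖ ≤ (cx + cC + c137 + c139 + 14 * B₁ + k₄ * B₁ / 2 + 2 * B₁) * ρ * eta F n K ^ 2) ∧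
    (∀ (ν : Fin (F.P K).d) (y : Site (F.P K) 0), ‖covLapFormT 1 (bgUnits F K U₀) Yf ν y‖ ≤ (cx + cC + c137 + c139 + 14 * B₁ + k₄ * B₁ / 2 + 2 * B₁) * ρ * eta F n K ^ 2) := by
  obtain ⟨h1, h2⟩ := secondOrder_of_eq111_rows hU₀ hp hq x b Yf hY hYsup hx hC h137 h139 hDPD
  have hη2 : 0 ≤ eta F n K ^ 2 := sq_nonneg _
  have hnY0 : 0 ≤ nY := (norm_nonneg _).trans (hYsup ⟨default, ⟨0, (F.P K).hd⟩⟩)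
  have hB : 0 ≤ B₁ / 2 * ρ := hnY0.trans hnY
  have e1 : 28 * ρ * nY ≤ 28 * ρ * (B₁ / 2 * ρ) := mul_le_mul_of_nonneg_left hnY (by positivity)
  have e2 : 28 * ρ * (B₁ / 2 * ρ) ≤ 28 * 1 * (B₁ / 2 * ρ) := mul_le_mul_of_nonneg_right (mul_le_mul_of_nonneg_left hρ1 (by norm_num)) hB
  have e3 : k₄ * nY ≤ k₄ * (B₁ / 2 * ρ) := mul_le_mul_of_nonneg_left hnY hk₄
  have e4 : 4 * ρ * nY ≤ 4 * ρ * (B₁ / 2 * ρ) := mul_le_mul_of_nonneg_left hnY (by positivity)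
  have e5 : 4 * ρ * (B₁ / 2 * ρ) ≤ 4 * 1 * (B₁ / 2 * ρ) := mul_le_mul_of_nonneg_right (mul_le_mul_of_nonneg_left hρ1 (by norm_num)) hB
  have hsum1 : sx + sC + s137 + s139 + 28 * ρ * nY ≤ (cx + cC + c137 + c139 + 14 * B₁ + k₄ * B₁ / 2 + 2 * B₁) * ρ := by
    have hk : 0 ≤ k₄ * (B₁ / 2 * ρ) := mul_nonneg hk₄ hB
    nlinarith
  have hsum2 : sx + sC + s137 + s139 + 28 * ρ * nY + k₄ * nY + 4 * ρ * nY ≤ (cx + cC + c137 + c139 + 14 * B₁ + k₄ * B₁ / 2 + 2 * B₁) * ρ := by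
    nlinarith
  refine ⟨fun μ y => (h1 μ y).trans ?_, fun ν y => (h2 ν y).trans ?_⟩
  · calc (sx + sC + s137 + s139 + 28 * ρ * nY) * eta F n K ^ 2
          ≤ ((cx + cC + c137 + c139 + 14 * B₁ + k₄ * B₁ / 2 + 2 * B₁) * ρ) * eta F n K ^ 2 := mul_le_mul_of_nonneg_right hsum1 hη2
      _ = (cx + cC + c137 + c139 + 14 * B₁ + k₄ * B₁ / 2 + 2 * B₁) * ρ * eta F n K ^ 2 := by ring
  · calc (sx + sC + s137 + s139 + 28 * ρ * nY + k₄ * nY + 4 * ρ * nY) * eta F n K ^ 2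
          ≤ ((cx + cC + c137 + c139 + 14 * B₁ + k₄ * B₁ / 2 + 2 * B₁) * ρ) * eta F n K ^ 2 := mul_le_mul_of_nonneg_right hsum2 hη2
      _ = (cx + cC + c137 + c139 + 14 * B₁ + k₄ * B₁ / 2 + 2 * B₁) * ρ * eta F n K ^ 2 := by ring

end Summit.QuantumFields.YangMills.Theorems.Prop7HessRowOfEq111

end
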